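import Mathlib
import HarnessLib.Audit
import Summits.PneNP.PneNP.Theorems.PstarPathRank

/-!
# A NOR-forced chord, II: leaf edges, induced matchings and the structure `2K₂` / cherry-plus-edge (ROUND-24, memo §9 R7/R8, O5)

FRONTIER range-avoidance ladder, rung F-N3, ROUND 24 (cell `pnp-ideate`, memo `r24/CORE-BOUND-NOTES.md` §9 R7, §10 O5, §13; restricted-model
proof complexity — nothing here bears on `P` versus `NP`).  GRAPH HALF of `PstarNorUnit` (pure combinatorics of the AND graph of a family `P`
of outputs of a pure `P⋆` instance with simple overlaps; the algebra is in `PstarNorUnitPolar`).  `adeg P v` = number of outputs of `P`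
holding `v` in an AND slot; `leafEdges P` = outputs both of whose AND variables have AND degree `1`.
* `isInducedMatching_insert_leafEdges`: for every `j₀ ∈ P`, `leafEdges P ∪ {j₀}` is an induced matching of the AND graph (simple overlaps);
* `card_leaves_le`: `#{v : adeg P v = 1} ≤ |P| + |leafEdges P|`;  `card_bdry_insert_le`: for `e` closing `P` into an XOR cycle,
  `#bdry(P ∪ {e}) ≤ 2 + #{v : adeg P v = 1}`;
* `two_edges_or_cherry` (structure theorem): `|P| ≥ 2`, no induced matching of size `3` (both from `PstarNorUnitPolar`), `e ∉ P` closing an XOR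
  cycle, `3(|P|+1) ≤ 2·#bdry(P ∪ {e})` ⟹ `P = {j₁, j₂}` with disjoint AND pairs (`2K₂`), or `P = {j₀, j₂, j₃}` with `j₀, j₂` sharing exactly
  one AND variable `c` (AND degree `2`, `c ∉ andPair j₃`) and every other variable of AND degree `≤ 1` (cherry plus edge).
-/

set_option linter.dupNamespace false -- `Summit.PneNP.PneNP.…`: summit = sub-problem name (D-0017 single-conjunct layout)

open Finset Literature.Computability.Complexity
open Summit.PneNP.PneNP.Theorems.PstarSALevel (varSet bdry SimpleOverlap)
open Summit.PneNP.PneNP.Theorems.PstarGapLinearised (andPair andPair_subset_varSet)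
open Summit.PneNP.PneNP.Theorems.PstarChordEndgameTools (mem_andPair_iff not_two_shared)
open Summit.PneNP.PneNP.Theorems.PstarCentreFree (vars_mem_varSet)
open Summit.PneNP.PneNP.Theorems.PstarNorCoreTools (not_mem_bdry_of_two eq_of_mem_bdry)
open Summit.PneNP.PneNP.Theorems.PstarProductRank (IsInducedMatching cover mem_cover)
open Summit.PneNP.PneNP.Theorems.PstarPathRank (and_ne andPair_ne)

namespace Summit.PneNP.PneNP.Theorems.PstarNorUnitGraph

variable {n m : ℕ}

/-! ## AND degrees and leaf edges -/

/-- The AND DEGREE of a variable in `P`: the number of outputs of `P` holding it in an AND slot. -/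
def adeg (I : LocalMap 4 n m) (P : Finset (Fin m)) (v : Fin n) : ℕ := (P.filter fun j => v ∈ andPair I j).card

/-- The LEAF EDGES of `P`: outputs both of whose AND variables have AND degree `1`. -/
def leafEdges (I : LocalMap 4 n m) (P : Finset (Fin m)) : Finset (Fin m) :=
  P.filter fun j => adeg I P (I.vars j 2) = 1 ∧ adeg I P (I.vars j 3) = 1

/-- Membership in `leafEdges`. -/
theorem mem_leafEdges {I : LocalMap 4 n m} {P : Finset (Fin m)} {j : Fin m} :
    j ∈ leafEdges I P ↔ j ∈ P ∧ adeg I P (I.vars j 2) = 1 ∧ adeg I P (I.vars j 3) = 1 := mem_filter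

/-- An AND variable of an output of `P` has positive AND degree. -/
theorem adeg_pos {I : LocalMap 4 n m} {P : Finset (Fin m)} {j : Fin m} (hj : j ∈ P) {v : Fin n} (hv : v ∈ andPair I j) :
    0 < adeg I P v :=
  card_pos.2 ⟨j, mem_filter.2 ⟨hj, hv⟩⟩

/-- **Leaves are exclusive**: if `adeg P v = 1` and `v` is an AND variable of `j ∈ P`, then no other output of `P` holds `v` in an AND slot. -/
theorem eq_of_adeg_eq_one {I : LocalMap 4 n m} {P : Finset (Fin m)} {v : Fin n} (hv : adeg I P v = 1) {j j' : Fin m} (hj : j ∈ P)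
    (hvj : v ∈ andPair I j) (hj' : j' ∈ P) (hvj' : v ∈ andPair I j') : j = j' := by
  unfold adeg at hv
  obtain ⟨j₀, hj₀⟩ := card_eq_one.1 hv
  have h1 : j ∈ P.filter (fun j => v ∈ andPair I j) := mem_filter.2 ⟨hj, hvj⟩
  have h2 : j' ∈ P.filter (fun j => v ∈ andPair I j) := mem_filter.2 ⟨hj', hvj'⟩
  rw [hj₀, mem_singleton] at h1 h2
  rw [h1, h2]

/-- A variable of AND degree at least two lies in the AND pairs of two distinct outputs of `P`. -/
theorem exists_two_of_two_le_adeg {I : LocalMap 4 n m} {P : Finset (Fin m)} {v : Fin n} (hv : 2 ≤ adeg I P v) :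
    ∃ j ∈ P, ∃ j' ∈ P, j ≠ j' ∧ v ∈ andPair I j ∧ v ∈ andPair I j' := by
  unfold adeg at hv
  obtain ⟨j, hj, j', hj', hne⟩ := one_lt_card.1 (show 1 < (P.filter fun j => v ∈ andPair I j).card by omega)
  rw [mem_filter] at hj hj'
  exact ⟨j, hj.1, j', hj'.1, hne, hj.2, hj'.2⟩

section Leaves

variable {I : LocalMap 4 n m} (hI : I.IsPure xorAndPred) (hS : SimpleOverlap I) {P : Finset (Fin m)}

include hI hS

/-- **`leafEdges P ∪ {j₀}` is an induced matching** of the AND graph of `P`, for every `j₀ ∈ P`: leaf edges are vertex-disjoint from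
everything else, and the only output with both AND variables among those of `j₀` is `j₀` itself (simple overlaps). -/
theorem isInducedMatching_insert_leafEdges {j₀ : Fin m} (hj₀ : j₀ ∈ P) :
    IsInducedMatching P (insert j₀ (leafEdges I P)) (fun j => I.vars j 2) (fun j => I.vars j 3) := by
  classical
  have hsub : insert j₀ (leafEdges I P) ⊆ P := by
    intro j hj
    rcases mem_insert.1 hj with rfl | hj
    · exact hj₀
    · exact (mem_leafEdges.1 hj).1
  -- a leaf edge shares no AND variable with any other output of `P`
  have m2 : ∀ j : Fin m, I.vars j 2 ∈ andPair I j := fun j => (mem_andPair_iff I j _).2 (Or.inl rfl)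
  have m3 : ∀ j : Fin m, I.vars j 3 ∈ andPair I j := fun j => (mem_andPair_iff I j _).2 (Or.inr rfl)
  have hleaf : ∀ j ∈ leafEdges I P, ∀ j' ∈ P, j ≠ j' → ∀ v, v ∈ andPair I j → v ∈ andPair I j' → False := by
    intro j hj j' hj' hne v hv hv'
    obtain ⟨hjP, h2, h3⟩ := mem_leafEdges.1 hj
    have h1 : adeg I P v = 1 := by
      rcases (mem_andPair_iff I j v).1 hv with rfl | rfl
      · exact h2
      · exact h3
    exact hne (eq_of_adeg_eq_one h1 hjP hv hj' hv')
  refine ⟨hsub, fun j _ => and_ne I hI j, ?_, ?_⟩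
  · intro j hj j' hj' hne
    have key : j ∈ leafEdges I P ∨ j' ∈ leafEdges I P := by
      rcases mem_insert.1 hj with rfl | h
      · rcases mem_insert.1 hj' with rfl | h'
        · exact absurd rfl hne
        · exact Or.inr h'
      · exact Or.inl h
    rcases key with h | h
    · have hj'P := hsub hj'
      refine ⟨fun e => hleaf j h j' hj'P hne _ (m2 j) ((mem_andPair_iff I j' _).2 (Or.inl e)),
        fun e => hleaf j h j' hj'P hne _ (m2 j) ((mem_andPair_iff I j' _).2 (Or.inr e)),
        fun e => hleaf j h j' hj'P hne _ (m3 j) ((mem_andPair_iff I j' _).2 (Or.inl e)),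
        fun e => hleaf j h j' hj'P hne _ (m3 j) ((mem_andPair_iff I j' _).2 (Or.inr e))⟩
    · have hjP := hsub hj
      refine ⟨fun e => hleaf j' h j hjP hne.symm _ (m2 j') ((mem_andPair_iff I j _).2 (Or.inl e.symm)),
        fun e => hleaf j' h j hjP hne.symm _ (m3 j') ((mem_andPair_iff I j _).2 (Or.inl e.symm)),
        fun e => hleaf j' h j hjP hne.symm _ (m2 j') ((mem_andPair_iff I j _).2 (Or.inr e.symm)),
        fun e => hleaf j' h j hjP hne.symm _ (m3 j') ((mem_andPair_iff I j _).2 (Or.inr e.symm))⟩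
  · intro j' hj' hp hq
    rw [mem_cover] at hp hq
    obtain ⟨a, ha, hpa⟩ := hp
    obtain ⟨b, hb, hqb⟩ := hq
    by_cases hj'L : j' ∈ insert j₀ (leafEdges I P)
    · exact hj'L
    exfalso
    have haj : a = j₀ := by
      rcases mem_insert.1 ha with rfl | haL
      · rfl
      · exfalso
        have hne : a ≠ j' := fun h => hj'L (h ▸ ha)
        rcases hpa with e | e
        · exact hleaf a haL j' hj' hne _ (m2 a) ((mem_andPair_iff I j' _).2 (Or.inl e.symm))
        · exact hleaf a haL j' hj' hne _ (m3 a) ((mem_andPair_iff I j' _).2 (Or.inl e.symm))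
    have hbj : b = j₀ := by
      rcases mem_insert.1 hb with rfl | hbL
      · rfl
      · exfalso
        have hne : b ≠ j' := fun h => hj'L (h ▸ hb)
        rcases hqb with e | e
        · exact hleaf b hbL j' hj' hne _ (m2 b) ((mem_andPair_iff I j' _).2 (Or.inr e.symm))
        · exact hleaf b hbL j' hj' hne _ (m3 b) ((mem_andPair_iff I j' _).2 (Or.inr e.symm))
    rw [haj] at hpa
    rw [hbj] at hqb
    have hne : j' ≠ j₀ := fun h => hj'L (h ▸ mem_insert_self _ _)
    have hne23 := and_ne I hI j'
    rcases hpa with e2 | e2 <;> rcases hqb with e3 | e3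
    · exact hne23 (e2.trans e3.symm)
    · exact andPair_ne I hI hS hne (Or.inl ⟨e2, e3⟩)
    · exact andPair_ne I hI hS hne (Or.inr ⟨e2, e3⟩)
    · exact hne23 (e2.trans e3.symm)

omit hI hS in
/-- **Counting leaves**: `#{v : adeg P v = 1} ≤ |P| + |leafEdges P|` (a leaf edge carries two leaves, any other output at most one). -/
theorem card_leaves_le : (univ.filter fun v => adeg I P v = 1).card ≤ P.card + (leafEdges I P).card := by
  classical
  have hcov : (univ.filter fun v => adeg I P v = 1) ⊆ P.biUnion fun j => (andPair I j).filter fun v => adeg I P v = 1 := by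
    intro v hv
    rw [mem_filter] at hv
    obtain ⟨j, hj⟩ := card_pos.1 (show 0 < adeg I P v by rw [hv.2]; exact Nat.one_pos)
    rw [mem_filter] at hj
    exact mem_biUnion.2 ⟨j, hj.1, mem_filter.2 ⟨hj.2, hv.2⟩⟩
  have hper : ∀ j ∈ P, ((andPair I j).filter fun v => adeg I P v = 1).card ≤ 1 + (if j ∈ leafEdges I P then 1 else 0) := by
    intro j hj
    by_cases hL : j ∈ leafEdges I P
    · rw [if_pos hL]
      exact (card_le_card (filter_subset _ _)).trans card_le_two
    · rw [if_neg hL, add_zero]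
      refine card_le_one.2 fun a ha b hb => ?_
      rw [mem_filter, mem_andPair_iff] at ha hb
      by_contra hab
      apply hL
      rw [mem_leafEdges]
      rcases ha with ⟨rfl | rfl, ha1⟩ <;> rcases hb with ⟨rfl | rfl, hb1⟩
      · exact absurd rfl hab
      · exact ⟨hj, ha1, hb1⟩
      · exact ⟨hj, hb1, ha1⟩
      · exact absurd rfl hab
  calc (univ.filter fun v => adeg I P v = 1).card
      ≤ (P.biUnion fun j => (andPair I j).filter fun v => adeg I P v = 1).card := card_le_card hcov
    _ ≤ ∑ j ∈ P, ((andPair I j).filter fun v => adeg I P v = 1).card := card_biUnion_le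
    _ ≤ ∑ j ∈ P, (1 + if j ∈ leafEdges I P then 1 else 0) := sum_le_sum hper
    _ = P.card + (leafEdges I P).card := by
        rw [sum_add_distrib, sum_const, smul_eq_mul, mul_one, sum_boole, Nat.cast_id]
        congr 1
        rw [filter_mem_eq_inter, inter_eq_right.2 (show leafEdges I P ⊆ P from filter_subset _ _)]

omit hI hS in
/-- **Boundary of the cycle family**: if no XOR variable of `P ∪ {e}` lies on the boundary of `P ∪ {e}`, then
`#bdry(P ∪ {e}) ≤ 2 + #{v : adeg P v = 1}` (the two AND variables of `e` and the leaves of `P`). -/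
theorem card_bdry_insert_le {e : Fin m} (he : e ∉ P)
    (hcyc : ∀ j ∈ insert e P, ∀ s : Fin 4, s.val < 2 → I.vars j s ∉ bdry I (insert e P)) :
    (bdry I (insert e P)).card ≤ 2 + (univ.filter fun v => adeg I P v = 1).card := by
  classical
  have hsub : bdry I (insert e P) ⊆ andPair I e ∪ univ.filter fun v => adeg I P v = 1 := by
    intro v hv
    have hv' := hv
    unfold PstarSALevel.bdry at hv'
    rw [mem_filter, card_eq_one] at hv'
    obtain ⟨j, hj⟩ := hv'.2
    have hjm : j ∈ (insert e P).filter fun j => v ∈ varSet I j := by rw [hj]; exact mem_singleton_self j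
    rw [mem_filter] at hjm
    obtain ⟨hjF, hvj⟩ := hjm
    have hvj' := hvj
    unfold PstarSALevel.varSet at hvj'
    obtain ⟨s, -, hs⟩ := mem_image.1 hvj'
    have hs2 : 2 ≤ s.val := by
      by_contra hlt
      exact hcyc j hjF s (by omega) (hs ▸ hv)
    have hvand : v ∈ andPair I j := by
      rw [mem_andPair_iff]
      have hs' : s.val = 2 ∨ s.val = 3 := by have := s.isLt; omega
      rcases hs' with h | h
      · exact Or.inl (by rw [← hs]; congr 1; exact Fin.ext h)
      · exact Or.inr (by rw [← hs]; congr 1; exact Fin.ext h)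
    rcases mem_insert.1 hjF with rfl | hjP
    · exact mem_union_left _ hvand
    · refine mem_union_right _ (mem_filter.2 ⟨mem_univ _, ?_⟩)
      unfold adeg
      refine le_antisymm ?_ (card_pos.2 ⟨j, mem_filter.2 ⟨hjP, hvand⟩⟩)
      refine card_le_one.2 fun a ha b hb => ?_
      rw [mem_filter] at ha hb
      have ha' := eq_of_mem_bdry I (mem_insert_of_mem ha.1) hjF hv (andPair_subset_varSet I a ha.2) hvj
      have hb' := eq_of_mem_bdry I (mem_insert_of_mem hb.1) hjF hv (andPair_subset_varSet I b hb.2) hvj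
      rw [ha', hb']
  calc (bdry I (insert e P)).card ≤ (andPair I e ∪ univ.filter fun v => adeg I P v = 1).card := card_le_card hsub
    _ ≤ (andPair I e).card + (univ.filter fun v => adeg I P v = 1).card := card_union_le _ _
    _ ≤ 2 + (univ.filter fun v => adeg I P v = 1).card := Nat.add_le_add_right card_le_two _

omit hI in
/-- Two distinct outputs sharing two AND variables contradict simple overlaps. -/
theorem eq_of_two_shared {j j' : Fin m} (hne : j ≠ j') {c d : Fin n} (hcd : c ≠ d) (hc : c ∈ andPair I j) (hc' : c ∈ andPair I j')
    (hd : d ∈ andPair I j) (hd' : d ∈ andPair I j') : False :=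
  not_two_shared I hS hne hcd (andPair_subset_varSet I j hc) (andPair_subset_varSet I j' hc') (andPair_subset_varSet I j hd)
    (andPair_subset_varSet I j' hd')

/-- **Structure theorem: `2K₂` or cherry-plus-edge.**  `P` with `|P| ≥ 2` and no induced matching of size three in its AND graph, `e ∉ P`
closing it into an XOR cycle, `P ∪ {e}` `3/2`-boundary expanding.  Then either `P` consists of two outputs with disjoint AND pairs, or of three
outputs `j₀, j₂, j₃` where `j₀, j₂` share an AND variable `c` of AND degree `2`, `c ∉ andPair j₃`, and every other variable has AND degree
at most `1`. -/
theorem two_edges_or_cherry (h2 : 2 ≤ P.card)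
    (hIM : ∀ M : Finset (Fin m), IsInducedMatching P M (fun j => I.vars j 2) (fun j => I.vars j 3) → M.card ≤ 2) {e : Fin m} (he : e ∉ P)
    (hcyc : ∀ j ∈ insert e P, ∀ s : Fin 4, s.val < 2 → I.vars j s ∉ bdry I (insert e P))
    (hexp : 3 * (insert e P).card ≤ 2 * (bdry I (insert e P)).card) :
    (∃ j₁ j₂ : Fin m, j₁ ≠ j₂ ∧ P = {j₁, j₂} ∧ Disjoint (andPair I j₁) (andPair I j₂)) ∨
    (∃ j₀ j₂ j₃ : Fin m, ∃ c : Fin n, j₀ ≠ j₂ ∧ j₀ ≠ j₃ ∧ j₂ ≠ j₃ ∧ P = {j₀, j₂, j₃} ∧ c ∈ andPair I j₀ ∧ c ∈ andPair I j₂ ∧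
      c ∉ andPair I j₃ ∧ adeg I P c = 2 ∧ ∀ v : Fin n, v ≠ c → adeg I P v ≤ 1) := by
  classical
  set L := (univ.filter fun v => adeg I P v = 1).card with hL
  set EL := leafEdges I P with hEL
  have hLle : L ≤ P.card + EL.card := card_leaves_le (I := I) (P := P)
  have hbd := card_bdry_insert_le (I := I) he hcyc
  rw [card_insert_of_notMem he] at hexp
  have h3 : 3 * P.card ≤ 2 * L + 1 := by omega
  have hELsub : EL ⊆ P := filter_subset _ _
  -- an output outside `leafEdges` has an AND variable of AND degree ≥ 2, shared with another output of `P`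
  have hshare : ∀ j₀ ∈ P, j₀ ∉ EL → ∃ c ∈ andPair I j₀, 2 ≤ adeg I P c ∧ ∃ j' ∈ P, j' ≠ j₀ ∧ c ∈ andPair I j' := by
    intro j₀ hj₀ hj₀L
    have key : ∃ c ∈ andPair I j₀, adeg I P c ≠ 1 := by
      by_contra hno
      push Not at hno
      exact hj₀L (mem_leafEdges.2 ⟨hj₀, hno _ ((mem_andPair_iff I j₀ _).2 (Or.inl rfl)), hno _ ((mem_andPair_iff I j₀ _).2 (Or.inr rfl))⟩)
    obtain ⟨c, hc, hc1⟩ := key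
    have hc2 : 2 ≤ adeg I P c := by have := adeg_pos hj₀ hc; omega
    obtain ⟨a, ha, b, hb, hab, hca, hcb⟩ := exists_two_of_two_le_adeg hc2
    by_cases haj : a = j₀
    · subst haj
      exact ⟨c, hc, hc2, b, hb, fun h => hab h.symm, hcb⟩
    · exact ⟨c, hc, hc2, a, ha, haj, hca⟩
  -- leaves of a leaf edge have AND degree exactly `1`
  have hleafdeg : ∀ j ∈ EL, ∀ v ∈ andPair I j, adeg I P v = 1 := by
    intro j hj v hv
    obtain ⟨-, h2, h3⟩ := mem_leafEdges.1 hj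
    rcases (mem_andPair_iff I j v).1 hv with rfl | rfl
    · exact h2
    · exact h3
  by_cases hall : P ⊆ EL
  · -- `P = leafEdges`: a perfect matching with at most two edges
    left
    have hPE : EL = P := Subset.antisymm hELsub hall
    obtain ⟨j₁, hj₁⟩ : P.Nonempty := card_pos.1 (by omega)
    have hc2 : P.card ≤ 2 := by
      have h := hIM _ (isInducedMatching_insert_leafEdges hI hS hj₁)
      rwa [← hEL, hPE, insert_eq_of_mem hj₁] at h
    have hc : P.card = 2 := le_antisymm hc2 h2
    obtain ⟨a, b, hab, hPab⟩ := card_eq_two.1 hc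
    refine ⟨a, b, hab, hPab, ?_⟩
    rw [Finset.disjoint_left]
    intro v hva hvb
    have ha : a ∈ EL := hall (hPab ▸ mem_insert_self _ _)
    have h1 := hleafdeg a ha v hva
    exact hab (eq_of_adeg_eq_one h1 (hPab ▸ mem_insert_self _ _) hva (hPab ▸ mem_insert_of_mem (mem_singleton_self _)) hvb)
  · -- some `j₀ ∈ P` outside `leafEdges`: then `|leafEdges| ≤ 1` and `|P| ≤ 3`
    right
    obtain ⟨j₀, hj₀, hj₀L⟩ := not_subset.1 hall
    have hEL1 : EL.card ≤ 1 := by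
      have h := hIM _ (isInducedMatching_insert_leafEdges hI hS hj₀)
      rw [← hEL, card_insert_of_notMem hj₀L] at h
      omega
    have hP3 : P.card ≤ 3 := by omega
    obtain ⟨c, hc, hc2, j', hj', hj'ne, hcj'⟩ := hshare j₀ hj₀ hj₀L
    have hj'L : j' ∉ EL := fun h => by have := hleafdeg j' h c hcj'; omega
    -- `|P| = 3`: otherwise `P = {j₀, j'}` has no leaf edge and `L ≤ 2`, contradicting expansion
    have hP : P.card = 3 := by
      by_contra hne3
      have hP2 : P.card = 2 := by omega
      have hEL0 : EL.card = 0 := by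
        rw [card_eq_zero]
        refine eq_empty_of_forall_notMem fun j hj => ?_
        have hjP := hELsub hj
        obtain ⟨a, b, hab, hPab⟩ := card_eq_two.1 hP2
        have hj₀ab : j₀ = a ∨ j₀ = b := by simpa [hPab] using hj₀
        have hj'ab : j' = a ∨ j' = b := by simpa [hPab] using hj'
        have hjab : j = a ∨ j = b := by simpa [hPab] using hjP
        rcases hjab with rfl | rfl <;> rcases hj₀ab with rfl | rfl
        · exact hj₀L hj
        · rcases hj'ab with rfl | rfl
          · exact hj'L hj
          · exact hj'ne rfl
        · rcases hj'ab with rfl | rfl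
          · exact hj'ne rfl
          · exact hj'L hj
        · exact hj₀L hj
      omega
    -- the third output `j₃` is the unique leaf edge
    have hEL1' : EL.card = 1 := by omega
    obtain ⟨j₃, hj₃⟩ := card_eq_one.1 hEL1'
    have hj₃E : j₃ ∈ EL := by rw [hj₃]; exact mem_singleton_self _
    have hj₃P : j₃ ∈ P := hELsub hj₃E
    have hj₀3 : j₀ ≠ j₃ := fun h => hj₀L (h ▸ hj₃E)
    have hj'3 : j' ≠ j₃ := fun h => hj'L (h ▸ hj₃E)
    have hPeq : P = {j₀, j', j₃} := by
      symm
      apply eq_of_subset_of_card_le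
      · intro j hj
        simp only [mem_insert, mem_singleton] at hj
        rcases hj with rfl | rfl | rfl
        · exact hj₀
        · exact hj'
        · exact hj₃P
      · rw [hP, card_insert_of_notMem, card_pair hj'3]
        simp only [mem_insert, mem_singleton, not_or]
        exact ⟨hj'ne.symm, hj₀3⟩
    -- `c ∉ andPair j₃`, and `adeg c = 2`
    have hc3 : c ∉ andPair I j₃ := fun h => by have := hleafdeg j₃ hj₃E c h; omega
    have hadegc : adeg I P c = 2 := by
      unfold adeg
      have hsub : (P.filter fun j => c ∈ andPair I j) ⊆ {j₀, j'} := by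
        intro j hj
        rw [mem_filter, hPeq] at hj
        simp only [mem_insert, mem_singleton] at hj ⊢
        rcases hj.1 with rfl | rfl | rfl
        · exact Or.inl rfl
        · exact Or.inr rfl
        · exact absurd hj.2 hc3
      have hle := (card_le_card hsub).trans (card_pair hj'ne.symm).le
      unfold adeg at hc2
      omega
    refine ⟨j₀, j', j₃, c, hj'ne.symm, hj₀3, hj'3, hPeq, hc, hcj', hc3, hadegc, fun v hvc => ?_⟩
    -- any other variable of AND degree ≥ 2 would be a second variable shared by `j₀` and `j'`
    by_contra hv2
    have hv2' : 2 ≤ adeg I P v := by omega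
    obtain ⟨a, ha, b, hb, hab, hva, hvb⟩ := exists_two_of_two_le_adeg hv2'
    have haL : a ∉ EL := fun h => by have := hleafdeg a h v hva; omega
    have hbL : b ∉ EL := fun h => by have := hleafdeg b h v hvb; omega
    have ha3 : a ≠ j₃ := fun h => haL (h ▸ hj₃E)
    have hb3 : b ≠ j₃ := fun h => hbL (h ▸ hj₃E)
    rw [hPeq] at ha hb
    simp only [mem_insert, mem_singleton] at ha hb
    have key : ({a, b} : Finset (Fin m)) = {j₀, j'} := by
      apply eq_of_subset_of_card_le
      · intro j hj
        simp only [mem_insert, mem_singleton] at hj ⊢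
        rcases hj with rfl | rfl
        · rcases ha with h | h | h
          · exact Or.inl h
          · exact Or.inr h
          · exact absurd h ha3
        · rcases hb with h | h | h
          · exact Or.inl h
          · exact Or.inr h
          · exact absurd h hb3
      · rw [card_pair hj'ne.symm, card_pair hab]
    have hva' : v ∈ andPair I j₀ := by
      have : j₀ ∈ ({a, b} : Finset (Fin m)) := by rw [key]; exact mem_insert_self _ _
      simp only [mem_insert, mem_singleton] at this
      rcases this with rfl | rfl
      · exact hva
      · exact hvb
    have hvb' : v ∈ andPair I j' := by
      have : j' ∈ ({a, b} : Finset (Fin m)) := by rw [key]; exact mem_insert_of_mem (mem_singleton_self _)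
      simp only [mem_insert, mem_singleton] at this
      rcases this with rfl | rfl
      · exact hva
      · exact hvb
    exact eq_of_two_shared hS hj'ne.symm hvc hva' hvb' hc hcj'

end Leaves

end Summit.PneNP.PneNP.Theorems.PstarNorUnitGraph
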